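/-
Copyright (c) 2026 the pub-hodgecm-mathlib formalisation cell (harness21).  Prover seat hodgecm-mathlib-K2Liu-p13 (g4), Track B «K2-LIT»,
#184♮ = hLiu418 = `stmt-HodgeConjecture-24832`; ROAD Φ (RULING «M-156n»), #41 TOP, (β) END-file brick (E10c) of the census `CENSUS-Beta-EndFile.K2Liu-p13-g4.md`:
CURRENCY TRANSPORT `unipDeltaLocal ↔ unipDeltaLoc v` FOR ARBITRARY INTEGRANDS — every statement about the D10 local intertwining functional
`(G, h) ↦ ∫_{unipDeltaLocal} G(w_Δ u h) dνN(u)`, the volumes `νN{u | ↑u ∈ A}` and the integrability of `u ↦ Φ(↑u)`, valid for ALL Haar measures `νN`, holds verbatim for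
★ (E3)'s global-comap subgroup `unipDeltaLoc v` with `(w_Δ)_v = evalPlace v (finPart w_Δ)` and ANY Haar measure `ν` on it (★ B1 `unipDeltaLoc_eq_unipDeltaLocal`, `subst`).
THEOREMS ONLY (no `def`, no `instance`, no named-fact hypothesis, no `sorry`).
-/
import Summits.HodgeConjecture.HodgeConjecture.Theorems.K2LiuLocalWhittakerFactorSkew     -- ★ `evalPlace_finPart_weylDelta`; brings ★ B1 `unipDeltaLoc_eq_unipDeltaLocal`, ★ D10 `localIntertwining`
import HarnessLib

/-!
# Crux `HLiu418`, ROAD Φ, organ Φ8 (row G6), brick (E10c): TRANSPORT OF THE LOCAL INTERTWINING FUNCTIONAL FROM ★ D10's `unipDeltaLocal` TO ★ (E3)'s `unipDeltaLoc v`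

Cell `hodgecm-mathlib`, crux item hLiu418 = `stmt-HodgeConjecture-24832` (helper lane, count-neutral).  The producers of the (β) local letters — ★ A7-AllS0
`K2LiuA7NormalisedRegularityCMAllS0.normalisedRegularity_cm_allS0` (value `M_v(s)(f s) h = aNorm·Fn`), the integrability export (E9), the reflattening (E10b) — speak ★ D10:
`localIntertwining F E c v n hJD νN G h = ∫ u : unipDeltaLocal, G (weylDelta_v * ↑u * h) ∂νN`, for EVERY Haar `νN` on `unipDeltaLocal`.  The consumer ★ (E3)
`exists_eulerHead_intertwiningDelta` integrates over the global-comap subgroup `unipDeltaLoc L e dV hdV dW hdW v` against `(w_Δ)_v := evalPlace v (finPart w_Δ)`.  The two subgroups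
are EQUAL (★ B1) and `(w_Δ)_v` IS the local Weyl element (★ `evalPlace_finPart_weylDelta`), so (the `subst` pattern of ★ (F-GK-4) §1 `integral_weylDelta_mul_eq_of_localIntertwining_eq`):
* §1 **`transport_of_forall_haar`** (generic doubled datum, any rank, any subgroup `N′ = unipDeltaLocal`): for every predicate `Q` of (the intertwining functional, the volume
  functional `A ↦ ν.real{u | ↑u ∈ A}`, the integrability functional `Φ ↦ Integrable (Φ ∘ ↑)`), `(∀ Haar νN on unipDeltaLocal, Q(M_{νN}, vol_{νN}, Int_{νN})) → Q(∫_{N′} · dν, vol_ν, Int_ν)`;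
  corollaries **`integrable_comp_of_forall_haar`** and **`exists_value_of_forall_haar`** (the exact shapes of (E9) and of ★ A7-AllS0's `∃ Fn, P Fn ∧ ∀ s, 1 < re s → ∀ h, M(f s) h = R vol s · Fn s h`).
* §2 THE CM DATUM at `N′ := unipDeltaLoc v`: **`transport_unipDeltaLoc`**, **`integrable_unipDeltaLoc_of_forall_haar`**, **`exists_value_unipDeltaLoc_of_forall_haar`** — conclusions literally in
  ★ (E3)'s integrand `G ((evalPlace v (finPart w_Δ)) * ↑y * h)`.
Sources: [Casselman1980, §3]; [KudlaSweet1997, §1]; [MoeglinWaldspurger1995, I.2.1]; [Kudla1994, §3]; [Weil1965, §37].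
HONEST LABEL.  Helper lemmas, count-neutral; `HC_CM` is proved only modulo the 7 printed citations (2 remaining named inputs:
hLiu418 = `stmt-HodgeConjecture-24832`, h413 = `stmt-HodgeConjecture-24833`) until rung 0 closes.
-/

set_option autoImplicit false
set_option linter.dupNamespace false -- the mandated namespace repeats `HodgeConjecture.HodgeConjecture`

noncomputable section

open NumberField IsDedekindDomain Matrix MeasureTheory
open Literature.NumberTheory.Automorphic Literature.NumberTheory.Automorphic.UnitaryGroup Literature.NumberTheory.GaloisRepresentations
open Literature.NumberTheory.GelbartRogawski1991 Literature.NumberTheory.GelbartRogawski1991.GRConstruction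
open Literature.NumberTheory.GelbartRogawski1991.AdaptedBlocks
open Literature.NumberTheory.GelbartRogawski1991.UnitaryDualPair Literature.NumberTheory.GelbartRogawski1991.UnitaryDualPair.LocalSplitting
open Literature.NumberTheory.K2Lit Literature.NumberTheory.K2Lit.SiegelDoubled Literature.NumberTheory.K2Lit.LocalSiegelDoubled
open Summit.HodgeConjecture.HodgeConjecture.Cruxes.HLiu418.K2LiuSiegelUnipotentLocalDefs
open Summit.HodgeConjecture.HodgeConjecture.Cruxes.HLiu418.K2LiuUnipDeltaLocBridge (unipDeltaLoc_eq_unipDeltaLocal)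
open Summit.HodgeConjecture.HodgeConjecture.Cruxes.HLiu418.K2LiuLocalWhittakerFactorSkew (evalPlace_finPart_weylDelta)

namespace Summit.HodgeConjecture.HodgeConjecture.Cruxes.HLiu418.K2LiuUnipDeltaLocIntegralTransport

/-! ## §1 Generic doubled datum: any subgroup `N′ = unipDeltaLocal` -/

section Generic

variable (F : Type) [Field F] [NumberField F] (E : Type) [Field E] [NumberField E] [Algebra F E] (c : E ≃ₐ[F] E)
  (v : HeightOneSpectrum (𝓞 F)) (n : ℕ)
  {T₀ : Matrix (Fin n) (Fin n) F} {JD : Matrix (Fin (n + n)) (Fin (n + n)) E} (hJD : JD = (gramD F n T₀).map (algebraMap F E))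

/-- **TRANSPORT OF EVERY STATEMENT ABOUT (INTERTWINING FUNCTIONAL, VOLUMES, INTEGRABILITY) FROM `unipDeltaLocal` TO A SUBGROUP `N′ = unipDeltaLocal`.**  If `Q` holds for
the triple `(M_{νN}, A ↦ νN.real{u | ↑u ∈ A}, Φ ↦ Integrable (Φ ∘ ↑) νN)` for EVERY Haar measure `νN` on ★ D10's `unipDeltaLocal`, then it holds for
`((G,h) ↦ ∫_{N′} G(w_Δ ↑u h) dν, A ↦ ν.real{u | ↑u ∈ A}, Φ ↦ Integrable (Φ ∘ ↑) ν)` for every Haar `ν` on `N′` (`subst`). [cite: Casselman1980, §3] [cite: Weil1965, §37] -/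
theorem transport_of_forall_haar {N' : Subgroup (UnitaryGroup.localPi E c (n + n) JD v)} (hN' : N' = unipDeltaLocal F E c v n (JD := JD))
    [MeasurableSpace N'] [BorelSpace N'] (ν : Measure N') [ν.IsHaarMeasure]
    (Q : ((UnitaryGroup.localPi E c (n + n) JD v → ℂ) → UnitaryGroup.localPi E c (n + n) JD v → ℂ) →
      (Set (UnitaryGroup.localPi E c (n + n) JD v) → ℝ) → ((UnitaryGroup.localPi E c (n + n) JD v → ℂ) → Prop) → Prop)
    (hQ : ∀ {_ : MeasurableSpace (unipDeltaLocal F E c v n (JD := JD))} [BorelSpace (unipDeltaLocal F E c v n (JD := JD))]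
      (νN : Measure (unipDeltaLocal F E c v n (JD := JD))) [νN.IsHaarMeasure],
      Q (localIntertwining F E c v n hJD νN) (fun A => νN.real {u | (u : UnitaryGroup.localPi E c (n + n) JD v) ∈ A})
        (fun Φ => Integrable (fun u : unipDeltaLocal F E c v n (JD := JD) => Φ (u : UnitaryGroup.localPi E c (n + n) JD v)) νN)) :
    Q (fun G h => ∫ u : N', G (weylDelta F E c v n hJD * (u : UnitaryGroup.localPi E c (n + n) JD v) * h) ∂ν)
      (fun A => ν.real {u : N' | (u : UnitaryGroup.localPi E c (n + n) JD v) ∈ A})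
      (fun Φ => Integrable (fun u : N' => Φ (u : UnitaryGroup.localPi E c (n + n) JD v)) ν) := by
  subst hN'
  exact hQ ν

/-- **INTEGRABILITY TRANSPORT**: `(∀ Haar νN on unipDeltaLocal, Integrable (Φ ∘ ↑) νN) → Integrable (Φ ∘ ↑) ν` on `N′ = unipDeltaLocal` (the shape of the export (E9)).
[cite: Casselman1980, §3] [cite: Weil1965, §37] -/
theorem integrable_comp_of_forall_haar {N' : Subgroup (UnitaryGroup.localPi E c (n + n) JD v)} (hN' : N' = unipDeltaLocal F E c v n (JD := JD))
    [MeasurableSpace N'] [BorelSpace N'] (ν : Measure N') [ν.IsHaarMeasure] (Φ : UnitaryGroup.localPi E c (n + n) JD v → ℂ)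
    (hΦ : ∀ {_ : MeasurableSpace (unipDeltaLocal F E c v n (JD := JD))} [BorelSpace (unipDeltaLocal F E c v n (JD := JD))]
      (νN : Measure (unipDeltaLocal F E c v n (JD := JD))) [νN.IsHaarMeasure],
      Integrable (fun u : unipDeltaLocal F E c v n (JD := JD) => Φ (u : UnitaryGroup.localPi E c (n + n) JD v)) νN) :
    Integrable (fun u : N' => Φ (u : UnitaryGroup.localPi E c (n + n) JD v)) ν := by
  subst hN'
  exact hΦ ν

/-- **VALUE TRANSPORT** (the shape of ★ A7-AllS0 `normalisedRegularity_cm_allS0`): `(∀ Haar νN, ∃ Fn, P Fn ∧ ∀ s, 1 < re s → ∀ h, M_{νN}(f s) h = R(νN{↑u ∈ K₀}) s · Fn s h)`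
`→ ∃ Fn, P Fn ∧ ∀ s, 1 < re s → ∀ h, ∫_{N′} f s (w_Δ ↑u h) dν = R(ν{↑u ∈ K₀}) s · Fn s h` on `N′ = unipDeltaLocal`. [cite: KudlaSweet1997, §1] [cite: Casselman1980, §3] -/
theorem exists_value_of_forall_haar {N' : Subgroup (UnitaryGroup.localPi E c (n + n) JD v)} (hN' : N' = unipDeltaLocal F E c v n (JD := JD))
    [MeasurableSpace N'] [BorelSpace N'] (ν : Measure N') [ν.IsHaarMeasure]
    (f : ℂ → UnitaryGroup.localPi E c (n + n) JD v → ℂ) (K₀ : Set (UnitaryGroup.localPi E c (n + n) JD v))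
    (P : (ℂ → UnitaryGroup.localPi E c (n + n) JD v → ℂ) → Prop) (R : ℝ → ℂ → ℂ)
    (hval : ∀ {_ : MeasurableSpace (unipDeltaLocal F E c v n (JD := JD))} [BorelSpace (unipDeltaLocal F E c v n (JD := JD))]
      (νN : Measure (unipDeltaLocal F E c v n (JD := JD))) [νN.IsHaarMeasure],
      ∃ Fn : ℂ → UnitaryGroup.localPi E c (n + n) JD v → ℂ, P Fn ∧ ∀ s : ℂ, 1 < s.re → ∀ h : UnitaryGroup.localPi E c (n + n) JD v,
        localIntertwining F E c v n hJD νN (f s) h = R (νN.real {u | (u : UnitaryGroup.localPi E c (n + n) JD v) ∈ K₀}) s * Fn s h) :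
    ∃ Fn : ℂ → UnitaryGroup.localPi E c (n + n) JD v → ℂ, P Fn ∧ ∀ s : ℂ, 1 < s.re → ∀ h : UnitaryGroup.localPi E c (n + n) JD v,
      ∫ u : N', f s (weylDelta F E c v n hJD * (u : UnitaryGroup.localPi E c (n + n) JD v) * h) ∂ν =
        R (ν.real {u : N' | (u : UnitaryGroup.localPi E c (n + n) JD v) ∈ K₀}) s * Fn s h := by
  subst hN'
  exact hval ν

end Generic

/-! ## §2 The CM datum: `N′ := unipDeltaLoc v`, `(w_Δ)_v = evalPlace v (finPart w_Δ)` -/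

section CM

variable (L : Type) [Field L] [NumberField L] [IsCMField L] {N M n : ℕ} (e : Fin N × Fin M ≃ Fin n)
  (dV : Fin N → L) (hdV : ∀ i, IsCMField.complexConj L (dV i) = dV i)
  (dW : Fin M → L) (hdW : ∀ i, IsCMField.complexConj L (dW i) = dW i)
  (v : HeightOneSpectrum (𝓞 (Fp L)))
  [MeasurableSpace ↥(unipDeltaLoc L e dV hdV dW hdW v)] [BorelSpace ↥(unipDeltaLoc L e dV hdV dW hdW v)] (ν : Measure ↥(unipDeltaLoc L e dV hdV dW hdW v)) [ν.IsHaarMeasure]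

set_option maxHeartbeats 800000 in -- MEASURED: 200 000 ✗ (`isDefEq`∕`whnf` on the statement) ∕ 400 000 ✗ (`whnf`) ∕ 800 000 (the K2Lit CM datum's binder telescope, same class as ★ (F-GK-4) `K2LiuSphericalSiegelValueCM`)
/-- **TRANSPORT TO ★ (E3)'s CURRENCY, CM DATUM, ANY RANK**: every `Q` of (intertwining functional, volumes, integrability) valid for all Haar `νN` on ★ D10's `unipDeltaLocal` holds for
`((G,h) ↦ ∫ y, G((evalPlace v (finPart w_Δ)) * ↑y * h) ∂ν, A ↦ ν.real{y | ↑y ∈ A}, Φ ↦ Integrable (Φ ∘ ↑) ν)` on `unipDeltaLoc v` (★ B1 + ★ `evalPlace_finPart_weylDelta`).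
[cite: MoeglinWaldspurger1995, I.2.1] [cite: Kudla1994, §3] [cite: Casselman1980, §3] -/
theorem transport_unipDeltaLoc
    (Q : ((UnitaryGroup.localPi L (IsCMField.complexConj L) (n + n) (hermD L e dV hdV dW hdW) v → ℂ) → UnitaryGroup.localPi L (IsCMField.complexConj L) (n + n) (hermD L e dV hdV dW hdW) v → ℂ) →
      (Set (UnitaryGroup.localPi L (IsCMField.complexConj L) (n + n) (hermD L e dV hdV dW hdW) v) → ℝ) →
      ((UnitaryGroup.localPi L (IsCMField.complexConj L) (n + n) (hermD L e dV hdV dW hdW) v → ℂ) → Prop) → Prop)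
    (hQ : ∀ {_ : MeasurableSpace ↥(unipDeltaLocal (Fp L) L (IsCMField.complexConj L) v n (JD := hermD L e dV hdV dW hdW))}
      [BorelSpace ↥(unipDeltaLocal (Fp L) L (IsCMField.complexConj L) v n (JD := hermD L e dV hdV dW hdW))]
      (νN : Measure ↥(unipDeltaLocal (Fp L) L (IsCMField.complexConj L) v n (JD := hermD L e dV hdV dW hdW))) [νN.IsHaarMeasure],
      Q (localIntertwining (Fp L) L (IsCMField.complexConj L) v n (hermD_eq_map_gramD L e dV hdV dW hdW) νN)
        (fun A => νN.real {u | (u : UnitaryGroup.localPi L (IsCMField.complexConj L) (n + n) (hermD L e dV hdV dW hdW) v) ∈ A})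
        (fun Φ => Integrable (fun u : ↥(unipDeltaLocal (Fp L) L (IsCMField.complexConj L) v n (JD := hermD L e dV hdV dW hdW)) =>
          Φ (u : UnitaryGroup.localPi L (IsCMField.complexConj L) (n + n) (hermD L e dV hdV dW hdW) v)) νN)) :
    Q (fun G h => ∫ y : ↥(unipDeltaLoc L e dV hdV dW hdW v),
          G (UnitaryGroup.evalPlace (Fp L) L (IsCMField.complexConj L) (n + n) (hermD L e dV hdV dW hdW) v
                (UnitaryGroup.finPart (Fp L) L (IsCMField.complexConj L) (n + n) (hermD L e dV hdV dW hdW) (SiegelDoubled.weylDelta L e dV hdV dW hdW)) *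
              (y : UnitaryGroup.localPi L (IsCMField.complexConj L) (n + n) (hermD L e dV hdV dW hdW) v) * h) ∂ν)
      (fun A => ν.real {y : ↥(unipDeltaLoc L e dV hdV dW hdW v) | (y : UnitaryGroup.localPi L (IsCMField.complexConj L) (n + n) (hermD L e dV hdV dW hdW) v) ∈ A})
      (fun Φ => Integrable (fun y : ↥(unipDeltaLoc L e dV hdV dW hdW v) => Φ (y : UnitaryGroup.localPi L (IsCMField.complexConj L) (n + n) (hermD L e dV hdV dW hdW) v)) ν) := by
  rw [evalPlace_finPart_weylDelta]
  exact transport_of_forall_haar (Fp L) L (IsCMField.complexConj L) v n (hermD_eq_map_gramD L e dV hdV dW hdW)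
    (unipDeltaLoc_eq_unipDeltaLocal L e dV hdV dW hdW v) ν Q hQ

set_option maxHeartbeats 800000 in -- MEASURED: 200 000 ✗ (`isDefEq`∕`whnf` on the statement) ∕ 400 000 ✗ (`whnf`) ∕ 800 000 (the K2Lit CM datum's binder telescope, same class as ★ (F-GK-4) `K2LiuSphericalSiegelValueCM`)
/-- **INTEGRABILITY IN ★ (E3)'s CURRENCY**: if `u ↦ Φ(↑u)` is integrable for every Haar `νN` on `unipDeltaLocal` (e.g. `Φ = f_s(w_Δ · h)`, export (E9)), then
`y ↦ Φ(↑y)` is `ν`-integrable on `unipDeltaLoc v` (the `w_Δ`-shaped form is the next lemma). [cite: Casselman1980, §3] [cite: Weil1965, §37] -/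
theorem integrable_unipDeltaLoc_of_forall_haar (Φ : UnitaryGroup.localPi L (IsCMField.complexConj L) (n + n) (hermD L e dV hdV dW hdW) v → ℂ)
    (hΦ : ∀ {_ : MeasurableSpace ↥(unipDeltaLocal (Fp L) L (IsCMField.complexConj L) v n (JD := hermD L e dV hdV dW hdW))}
      [BorelSpace ↥(unipDeltaLocal (Fp L) L (IsCMField.complexConj L) v n (JD := hermD L e dV hdV dW hdW))]
      (νN : Measure ↥(unipDeltaLocal (Fp L) L (IsCMField.complexConj L) v n (JD := hermD L e dV hdV dW hdW))) [νN.IsHaarMeasure],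
      Integrable (fun u : ↥(unipDeltaLocal (Fp L) L (IsCMField.complexConj L) v n (JD := hermD L e dV hdV dW hdW)) =>
        Φ (u : UnitaryGroup.localPi L (IsCMField.complexConj L) (n + n) (hermD L e dV hdV dW hdW) v)) νN) :
    Integrable (fun y : ↥(unipDeltaLoc L e dV hdV dW hdW v) => Φ (y : UnitaryGroup.localPi L (IsCMField.complexConj L) (n + n) (hermD L e dV hdV dW hdW) v)) ν :=
  integrable_comp_of_forall_haar (Fp L) L (IsCMField.complexConj L) v n (unipDeltaLoc_eq_unipDeltaLocal L e dV hdV dW hdW v) ν Φ hΦ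

set_option maxHeartbeats 800000 in -- MEASURED: 200 000 ✗ (`isDefEq`∕`whnf` on the statement) ∕ 400 000 ✗ (`whnf`) ∕ 800 000 (the K2Lit CM datum's binder telescope, same class as ★ (F-GK-4) `K2LiuSphericalSiegelValueCM`)
/-- **INTEGRABILITY OF THE `w_Δ`-SHAPED INTEGRAND IN ★ (E3)'s CURRENCY**: `(∀ Haar νN on unipDeltaLocal, Integrable (u ↦ G(w_Δ ↑u h)) νN) →
Integrable (y ↦ G((evalPlace v (finPart w_Δ)) ↑y h)) ν` on `unipDeltaLoc v`. [cite: Casselman1980, §3] [cite: Kudla1994, §3] -/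
theorem integrable_weylDelta_mul_unipDeltaLoc_of_forall_haar (G : UnitaryGroup.localPi L (IsCMField.complexConj L) (n + n) (hermD L e dV hdV dW hdW) v → ℂ)
    (h : UnitaryGroup.localPi L (IsCMField.complexConj L) (n + n) (hermD L e dV hdV dW hdW) v)
    (hG : ∀ {_ : MeasurableSpace ↥(unipDeltaLocal (Fp L) L (IsCMField.complexConj L) v n (JD := hermD L e dV hdV dW hdW))}
      [BorelSpace ↥(unipDeltaLocal (Fp L) L (IsCMField.complexConj L) v n (JD := hermD L e dV hdV dW hdW))]
      (νN : Measure ↥(unipDeltaLocal (Fp L) L (IsCMField.complexConj L) v n (JD := hermD L e dV hdV dW hdW))) [νN.IsHaarMeasure],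
      Integrable (fun u : ↥(unipDeltaLocal (Fp L) L (IsCMField.complexConj L) v n (JD := hermD L e dV hdV dW hdW)) =>
        G (UnitaryDualPair.LocalSplitting.weylDelta (Fp L) L (IsCMField.complexConj L) v n (hermD_eq_map_gramD L e dV hdV dW hdW) *
          (u : UnitaryGroup.localPi L (IsCMField.complexConj L) (n + n) (hermD L e dV hdV dW hdW) v) * h)) νN) :
    Integrable (fun y : ↥(unipDeltaLoc L e dV hdV dW hdW v) =>
      G (UnitaryGroup.evalPlace (Fp L) L (IsCMField.complexConj L) (n + n) (hermD L e dV hdV dW hdW) v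
            (UnitaryGroup.finPart (Fp L) L (IsCMField.complexConj L) (n + n) (hermD L e dV hdV dW hdW) (SiegelDoubled.weylDelta L e dV hdV dW hdW)) *
          (y : UnitaryGroup.localPi L (IsCMField.complexConj L) (n + n) (hermD L e dV hdV dW hdW) v) * h)) ν := by
  rw [evalPlace_finPart_weylDelta]
  exact integrable_comp_of_forall_haar (Fp L) L (IsCMField.complexConj L) v n (unipDeltaLoc_eq_unipDeltaLocal L e dV hdV dW hdW v) ν
    (fun x => G (UnitaryDualPair.LocalSplitting.weylDelta (Fp L) L (IsCMField.complexConj L) v n (hermD_eq_map_gramD L e dV hdV dW hdW) * x * h)) hG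

set_option maxHeartbeats 800000 in -- MEASURED: 200 000 ✗ (`isDefEq`∕`whnf` on the statement) ∕ 400 000 ✗ (`whnf`) ∕ 800 000 (the K2Lit CM datum's binder telescope, same class as ★ (F-GK-4) `K2LiuSphericalSiegelValueCM`)
/-- **VALUE IN ★ (E3)'s CURRENCY** (the shape of ★ A7-AllS0 at the CM datum, any `P`, `R`, `K₀`):
`(∀ Haar νN on unipDeltaLocal, ∃ Fn, P Fn ∧ ∀ s, 1 < re s → ∀ h, M_{νN}(f s) h = R(νN.real{↑u ∈ K₀}) s · Fn s h) →`
`∃ Fn, P Fn ∧ ∀ s, 1 < re s → ∀ h, ∫ y, f s ((evalPlace v (finPart w_Δ)) ↑y h) ∂ν = R(ν.real{↑y ∈ K₀}) s · Fn s h`. [cite: KudlaSweet1997, §1] [cite: HarrisKudlaSweet1996, §6 (6.14)–(6.16)] -/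
theorem exists_value_unipDeltaLoc_of_forall_haar (f : ℂ → UnitaryGroup.localPi L (IsCMField.complexConj L) (n + n) (hermD L e dV hdV dW hdW) v → ℂ)
    (K₀ : Set (UnitaryGroup.localPi L (IsCMField.complexConj L) (n + n) (hermD L e dV hdV dW hdW) v))
    (P : (ℂ → UnitaryGroup.localPi L (IsCMField.complexConj L) (n + n) (hermD L e dV hdV dW hdW) v → ℂ) → Prop) (R : ℝ → ℂ → ℂ)
    (hval : ∀ {_ : MeasurableSpace ↥(unipDeltaLocal (Fp L) L (IsCMField.complexConj L) v n (JD := hermD L e dV hdV dW hdW))}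
      [BorelSpace ↥(unipDeltaLocal (Fp L) L (IsCMField.complexConj L) v n (JD := hermD L e dV hdV dW hdW))]
      (νN : Measure ↥(unipDeltaLocal (Fp L) L (IsCMField.complexConj L) v n (JD := hermD L e dV hdV dW hdW))) [νN.IsHaarMeasure],
      ∃ Fn : ℂ → UnitaryGroup.localPi L (IsCMField.complexConj L) (n + n) (hermD L e dV hdV dW hdW) v → ℂ, P Fn ∧ ∀ s : ℂ, 1 < s.re →
        ∀ h : UnitaryGroup.localPi L (IsCMField.complexConj L) (n + n) (hermD L e dV hdV dW hdW) v,
          localIntertwining (Fp L) L (IsCMField.complexConj L) v n (hermD_eq_map_gramD L e dV hdV dW hdW) νN (f s) h =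
            R (νN.real {u | (u : UnitaryGroup.localPi L (IsCMField.complexConj L) (n + n) (hermD L e dV hdV dW hdW) v) ∈ K₀}) s * Fn s h) :
    ∃ Fn : ℂ → UnitaryGroup.localPi L (IsCMField.complexConj L) (n + n) (hermD L e dV hdV dW hdW) v → ℂ, P Fn ∧ ∀ s : ℂ, 1 < s.re →
      ∀ h : UnitaryGroup.localPi L (IsCMField.complexConj L) (n + n) (hermD L e dV hdV dW hdW) v,
        ∫ y : ↥(unipDeltaLoc L e dV hdV dW hdW v),
            f s (UnitaryGroup.evalPlace (Fp L) L (IsCMField.complexConj L) (n + n) (hermD L e dV hdV dW hdW) v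
                  (UnitaryGroup.finPart (Fp L) L (IsCMField.complexConj L) (n + n) (hermD L e dV hdV dW hdW) (SiegelDoubled.weylDelta L e dV hdV dW hdW)) *
                (y : UnitaryGroup.localPi L (IsCMField.complexConj L) (n + n) (hermD L e dV hdV dW hdW) v) * h) ∂ν =
          R (ν.real {y : ↥(unipDeltaLoc L e dV hdV dW hdW v) | (y : UnitaryGroup.localPi L (IsCMField.complexConj L) (n + n) (hermD L e dV hdV dW hdW) v) ∈ K₀}) s * Fn s h := by
  rw [evalPlace_finPart_weylDelta]
  exact exists_value_of_forall_haar (Fp L) L (IsCMField.complexConj L) v n (hermD_eq_map_gramD L e dV hdV dW hdW)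
    (unipDeltaLoc_eq_unipDeltaLocal L e dV hdV dW hdW v) ν f K₀ P R hval

end CM

end Summit.HodgeConjecture.HodgeConjecture.Cruxes.HLiu418.K2LiuUnipDeltaLocIntegralTransport

end
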